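import Mathlib.Analysis.Complex.Polynomial.Basic
import Literature.IUT.HodgeTheaters.TemperedFrobenioidConventions
import HarnessLib

/-!
# [IUTchI] Remark 3.2.4 (i)–(v): the interface `MeromorphicRootSetting` is inhabited, and its typed
# statements are jointly satisfiable and separately contentful (NV-L5, proof-only)

S. Mochizuki, *Inter-universal Teichmüller theory I*, §3, Remark 3.2.4 (i)–(v), kurims manuscript
(May 2020) pp. 75–77 [claim: Mochizuki2012, status: disputed].  The tree types the Remark over the
INTERFACE `Literature.IUT.HodgeTheaters.MeromorphicRootSetting` (abc-iut-L5 lineage,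
`TemperedFrobenioidConventions.lean`): a multiplicative group `Mer` ("nonzero meromorphic functions on
`Z^log_∞`"), a residue characteristic `p`, and the two predicates "admits an `N`-th root over some
tempered covering" / "has a log-divisor"; the printed implications "(b) ⇒ (c)", "(c) ⇒ (b)" and the
summary "(a) ⇒ (b) ⇔ (c)" are typed as the statements `BImpliesC`, `CImpliesB`, `SummaryImplications`.

This PROOF-ONLY file (0 `def`s; NV-L5 row `MeromorphicRootSetting`, L5-lead RULINGS #27) records:

* `nonempty_parameterRecord` — the interface is inhabited (universe `0`);
* `exists_parameterRecord_allStatements` — ONE parameter record at which EVERY typed statement of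
  Rmk 3.2.4 (i)/(ii)/(iv) holds simultaneously: `Mer := ℂˣ` (a divisible group: every element has an
  `N`-th root for every `N ≥ 1`, Mathlib `IsAlgClosed.exists_pow_nat_eq`), roots "over the trivial
  covering", every divisor declared a log-divisor.  HONEST LABEL `_parameterRecord`: this is NOT the
  tempered-covering model of [EtTh] §3 (owner abc-iut-L2-t3); it certifies joint satisfiability of the
  typed hypothesis package, nothing about `Z^log_∞`;
* `exists_parameterRecord_not_cImpliesB`, `exists_parameterRecord_not_bImpliesC` — parameter records
  at which "(c) ⇒ (b)" resp. "(b) ⇒ (c)" FAIL (`Mer := ℤ` written multiplicatively, where `1` has no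
  cube root; resp. `ℂˣ` with no log-divisors), so neither typed implication is a tautology of the
  interface: both are genuine constraints on the data, as print intends.

Nothing of the series is asserted; no side is taken on [IUTchIII] Cor. 3.12; instantiated ≠ endorsed.
-/

namespace Literature.IUT.HodgeTheaters

namespace MeromorphicRootSetting

/-- In `ℂˣ` every element has an `N`-th root for every `N ≥ 1` (ℂ is algebraically closed).
[folklore] -/
private theorem exists_pow_eq_units_complex (u : ℂˣ) {N : ℕ} (hN : 1 ≤ N) : ∃ g : ℂˣ, g ^ N = u := by
  obtain ⟨z, hz⟩ := IsAlgClosed.exists_pow_nat_eq (u : ℂ) (Nat.lt_of_lt_of_le Nat.zero_lt_one hN)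
  have hz0 : z ≠ 0 := by
    rintro rfl
    rw [zero_pow (by omega)] at hz
    exact u.ne_zero hz.symm
  exact ⟨Units.mk0 z hz0, Units.ext (by simp [hz])⟩

/-- **NV-L5 `MeromorphicRootSetting` (parameter record).**  The interface of [IUTchI] Rmk 3.2.4 (i) is
inhabited: `Mer := ℂˣ`, `p := 2`, "admits an `N`-th root" := has an `N`-th root in `ℂˣ`, "has a
log-divisor" := `True`.  `_parameterRecord`: not the [EtTh] §3 model. ([IUTchI] Rmk 3.2.4 (i) p.75)
[claim: Mochizuki2012, status: disputed] -/
theorem nonempty_parameterRecord : Nonempty MeromorphicRootSetting.{0} :=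
  ⟨{ Mer := ℂˣ, p := 2, AdmitsRootOverTempered := fun f N => ∃ g : ℂˣ, g ^ N = f,
     HasLogDivisor := fun _ => True }⟩

/-- **Joint satisfiability of the typed statements of Rmk 3.2.4** at ONE parameter record
(`Mer := ℂˣ`, roots in `ℂˣ`, all divisors log-divisors, `p := 2`): "(b) ⇒ (c)" (`BImpliesC`),
"(c) ⇒ (b)" (`CImpliesB`), the summary "(a) ⇒ (b) ⇔ (c)" (`SummaryImplications`), "(ii) the theta
function satisfies (a)" for EVERY element (`ThetaSatisfiesA`), and every element is
tempered-meromorphic in the sense of convention (A) (`IsTemperedMeromorphic`); the record's group is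
`ℂˣ` on the nose.  `_parameterRecord` (not the tempered-covering model). ([IUTchI] Rmk 3.2.4 (i) p.75)
[claim: Mochizuki2012, status: disputed] -/
theorem exists_parameterRecord_allStatements :
    ∃ Z : MeromorphicRootSetting.{0}, Z.BImpliesC ∧ Z.CImpliesB ∧ Z.SummaryImplications ∧
      (∀ θ : Z.Mer, Z.ThetaSatisfiesA θ) ∧ (∀ f : Z.Mer, Z.IsTemperedMeromorphic f) ∧
      (∀ f : Z.Mer, Z.CondA f ∧ Z.CondB f ∧ Z.CondC f) ∧ Z.p = 2 ∧ Nonempty (Z.Mer ≃* ℂˣ) := by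
  let Z : MeromorphicRootSetting.{0} :=
    { Mer := ℂˣ, p := 2, AdmitsRootOverTempered := fun f N => ∃ g : ℂˣ, g ^ N = f,
      HasLogDivisor := fun _ => True }
  have hA : ∀ f : Z.Mer, Z.CondA f := fun f N hN => exists_pow_eq_units_complex f hN
  have hBC : Z.BImpliesC := fun _ _ => trivial
  have hCB : Z.CImpliesB := fun f _ => Z.condB_of_condA f (hA f)
  exact ⟨Z, hBC, hCB, Z.summaryImplications_of hBC hCB, hA, hA,
    fun f => ⟨hA f, Z.condB_of_condA f (hA f), trivial⟩, rfl, ⟨MulEquiv.refl _⟩⟩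

/-- In `ℤ` (written multiplicatively) the generator has no cube root. [folklore] -/
private theorem not_exists_pow_three_eq_ofAdd_one :
    ¬ ∃ g : Multiplicative ℤ, g ^ 3 = Multiplicative.ofAdd 1 := by
  rintro ⟨g, hg⟩
  have h := congrArg Multiplicative.toAdd hg
  rw [toAdd_pow, toAdd_ofAdd, nsmul_eq_mul] at h
  push_cast at h
  omega

/-- **"(c) ⇒ (b)" is NOT a tautology of the interface**: at the parameter record `Mer := ℤ`
(multiplicatively), `p := 2`, roots taken in `Mer`, every divisor a log-divisor, condition (c) holds
for the generator while (b) fails at `N = 3` (prime to `2`; the generator has no cube root) — so the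
typed `CImpliesB` is a genuine constraint on the data ([IUTchI] derives it from admissible coverings,
[PrfGC] §2, §8), while `BImpliesC` holds there. `_parameterRecord`. ([IUTchI] Rmk 3.2.4 (i) p.76)
[claim: Mochizuki2012, status: disputed] -/
theorem exists_parameterRecord_not_cImpliesB :
    ∃ Z : MeromorphicRootSetting.{0}, Z.BImpliesC ∧ ¬ Z.CImpliesB := by
  refine ⟨{ Mer := Multiplicative ℤ, p := 2,
            AdmitsRootOverTempered := fun f N => ∃ g : Multiplicative ℤ, g ^ N = f,
            HasLogDivisor := fun _ => True }, fun _ _ => trivial, fun h => ?_⟩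
  have h3 := h (Multiplicative.ofAdd (1 : ℤ)) trivial 3 (by norm_num) (by decide)
  exact not_exists_pow_three_eq_ofAdd_one h3

/-- **"(b) ⇒ (c)" is NOT a tautology of the interface** either: at `Mer := ℂˣ` with every root
available but NO divisor declared a log-divisor, (b) holds for `1` and (c) fails — the typed
`BImpliesC` ("by considering the ramification divisors of the tempered coverings that arise from
extracting roots") is a genuine constraint, while `CImpliesB` holds there. `_parameterRecord`.
([IUTchI] Rmk 3.2.4 (i) p.76) [claim: Mochizuki2012, status: disputed] -/
theorem exists_parameterRecord_not_bImpliesC :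
    ∃ Z : MeromorphicRootSetting.{0}, Z.CImpliesB ∧ ¬ Z.BImpliesC := by
  refine ⟨{ Mer := ℂˣ, p := 2, AdmitsRootOverTempered := fun f N => ∃ g : ℂˣ, g ^ N = f,
            HasLogDivisor := fun _ => False }, fun f h => absurd h id, fun h => ?_⟩
  exact h 1 fun N hN _ => exists_pow_eq_units_complex 1 hN

/-- The three records side by side: the typed summary "(a) ⇒ (b) ⇔ (c)" holds at some parameter record
and fails at others — it is exactly as strong as the two non-formal implications it packages
(`summaryImplications_of`). `_parameterRecord`. ([IUTchI] Rmk 3.2.4 (i) p.76)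
[claim: Mochizuki2012, status: disputed] -/
theorem summaryImplications_contentful :
    (∃ Z : MeromorphicRootSetting.{0}, Z.SummaryImplications) ∧
      ∃ Z : MeromorphicRootSetting.{0}, ¬ Z.SummaryImplications := by
  refine ⟨?_, ?_⟩
  · obtain ⟨Z, -, -, h, -⟩ := exists_parameterRecord_allStatements
    exact ⟨Z, h⟩
  · obtain ⟨Z, -, h⟩ := exists_parameterRecord_not_cImpliesB
    exact ⟨Z, fun hs => h fun f hc => (hs.2 f).2 hc⟩

end MeromorphicRootSetting

end Literature.IUT.HodgeTheaters
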